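import Summits.QuantumFields.YangMills.Theorems.BalabanUVNodesProp4ColumnsAtRecord
import Summits.QuantumFields.YangMills.Theorems.BalabanUVNodesC44IterMhProp4Node00Pr
import HarnessLib

/-!
# [B11] PROP. 4 AT THE RECORD, FRAMED EDITION (ρ-frame-min) — (ℓd)ᵖʳ FROM THE PRIMITIVE KERNEL LETTERS AND THE NODE-00 DOOR, re-keyed at node00-def-Y's framed slots
# `H := H1prOfRecordAtBg … 𝔥`, `C := CslprOfRecord … 𝔥`, `Δπ` at `QprimeOfRecord U₀` ((A3) ✓`Node00.BgLettersPrOfRecord`) — twins of ✓`BalabanUVNodesProp4ColumnsAtRecord` §2–§3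

Cell `pub-ymgap` ∕ `ym-nodeO-ideate`, porter lineage `ymgap-nodeO-port-PTB-1` (gen 9); re-press (B) of director-ym g23 №608 (ROAD WORD FINAL), «the 7 G-door names» part 2; filed behind
(A3) ✓p829152, the G-door part 1 ✓`…Prop4UniformAtRecordPr` and the doors ✓`…C44IterMhProp4Node00Pr`; `--kind proof --supports stmt-QuantumFields-27238 --as helper`; count-neutral;
NEW basename, append-nothing.  [B7] = [Balaban1985Averaging]; [B9] = [Balaban1985BackgroundPropagators]; [B11] = [Balaban1985Variational].

RE-KEYING RULE (def-Y PRICE #2 (B)): `H1OfRecordAtBgFlat … levB a hpos♭ hQ ↦ H1prOfRecordAtBg … 𝔥 levB a hpos hQ` (the H₁ pin at the framed triple `(Q^{pr}(U₀), QprimeOfRecord U₀,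
R(QprimeOfRecord))`), `CslOfRecord ↦ CslprOfRecord … 𝔥`, `Δπ` at `Q′♭ ↦ QprimeOfRecord U₀`, `Prop4…AtRecord ↦ Prop4…PrAtRecord … 𝔥`, `C₂ ↦ 3.2·10¹⁶·L·N`, and the (ℓa-C)ᵖʳ supplier
✓`prop4LetterCPrAtRecord_of_regular` threads its DISPLAYED binders `hc`, (hdom), (hnear) into the node-00 door.  The generic §1 carrier ✓`prop4LetterColumns_of_kernelLetters` is
chart-free and reused verbatim; proofs word for word.

WHAT IS PROVED (0 def, 0 sorry, axioms standard; ns `Summit.QuantumFields.YangMills.Theorems.Prop4UniformAtRecord`): ★ `prop4LetterColumns_recordPr_of_kernelLetters`,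
★★ `prop4LetterColumnsPrAtRecord_of_kernelLetters` ((ℓd)ᵖʳ from (ℓa-H)ᵖʳ, (ℓa-C)ᵖʳ, the numbers and the three primitive kernel letters (KL-H)ᵖʳ∕(KL-C)ᵖʳ∕(KL-N)ᵖʳ of the FRAMED
`H₁`, `D C^{sl,pr}`, `Δπ∘H₁`), ★★★ `prop4UniformPrAtRecord_node00_of_kernelLetters` (the framed Prop. 4 at the record in the node-00 regime from (ℓa-H)ᵖʳ + the kernel letters + (14)).

HONEST FRAMING.  Glue re-keyed: (ℓa-H)ᵖʳ, (KL-H)ᵖʳ, (KL-N)ᵖʳ are (R1)-class and (KL-C)ᵖʳ is [B7]-Prop.-5-class — DISPLAYED binders, NOT proved; (ℓa-C)ᵖʳ filled only in the small-field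
approximation MODULO (hdom)∕(hnear), proved for NO non-trivial frame ((A1) is node00-def-Y's); constants crude; (R1)∕(R2) OPEN; K0ᴬ ⟨stmt-QuantumFields-27238⟩ NOT closed; NODE O 0∕1;
COUNT 8∕28 · K 1∕4 UNMOVED; finite `𝕋⁴_{L^K}` at fixed ε — NOT continuum ∕ ℝ⁴ ∕ OS ∕ Clay; **the Yang–Mills mass gap (Clay) is NOT proved by any of this.**  No `sorry`, `instance`,
`notation`, `set_option`; standard axioms.
-/

noncomputable section

open scoped Matrix Matrix.Norms.L2Operator InnerProductSpace ComplexConjugate BigOperators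

namespace Summit.QuantumFields.YangMills.Theorems.Prop4UniformAtRecord

open Literature.MathematicalPhysics.QuantumFieldTheory.Balaban1983to89
open T4Continuum BlockAveraging
open B9SectCLatticeCarrier (Bond)
open B11Eq103H1Complex (SiteL2K)
open B11Eq111FrakG (nabla115)
open B11Eq115Space (NegSup NegSize Space115 levWeight levWeight_pos)
open B11Eq90Transpose (kernel single115)
open B11Eq90V0primeCurrent (flat115)
open B11Prop6Scheme (Prop4Hyp)
open B11Eq118RegimeRadiiUniform (radius_pos)
open Node00
open Summit.QuantumFields.YangMills.Theorems.C44IterMh (prop4LetterCPrAtRecord_of_regular prop4UniformPrAtRecord_node00_of_HCol_pos)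

section Record

variable (F : T4Family) (N : ℕ) [NeZero N] (K k : ℕ) (Ω : ℕ → Set (Site (F.P K) 0)) (U₀ : GaugeField (F.P K) 0 (SU N))
variable [Fact (0 < (F.L : ℝ))] [Fact (0 < (F.P K).eta k)] [Fact (0 < c0Rec F K k)] [Fact (∀ c, 0 < wBRec F K k c)]

/-! ## §1  (ℓd)ᵖʳ at the framed slots from the primitive kernel letters (twins of ✓`prop4LetterColumns_record_of_kernelLetters` ∕ ✓`prop4LetterColumnsAtRecord_of_kernelLetters`) -/

/-- ★ **(ℓd)'s SHAPE AT THE RECORD's `H`, `C` SLOTS FOR ANY CURRENT-VALUED READER `N`** (`H := H1prOfRecordAtBg … 𝔥`, `C := CslprOfRecord … 𝔥` (FRAMED twin), `N : 𝒴 →L |·|₍₋₃₎` free): §1 with the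
record's (ℓa-H)∕(ℓa-C) letters by name.  (Stated with `N` free so that the generic-vs-record instance bookkeeping is settled once, here.)
[cite: Balaban1985Variational, (86)–(89) p.291, Prop. 4 (97)–(98) pp.292–293] -/
theorem prop4LetterColumns_recordPr_of_kernelLetters [DecidableEq (PBond (F.P K) k)] (𝔥 : FrameDatum (F.P K) N k U₀) (levB : PBond (F.P K) k → ℕ) (a : ℝ)
    (Ncur : Space115Lit F N K k Ω U₀ →L[ℂ] NegSizeLit F N K k Ω 3)
    (hpos : ∀ x, x ≠ 0 → 0 < RCLike.re ⟪x, laplaceAOfRecord F N k U₀ (QprOfRecord F N k U₀ 𝔥) (QprimeOfRecord F N k U₀) a x⟫_ℂ)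
    (hQ : Function.Surjective (QprOfRecord F N k U₀ 𝔥))
    {b C₂ c₄ aC εC RV R' : ℝ} (hH : Prop4LetterHPrAtRecord F N K k Ω U₀ 𝔥 levB a hpos hQ b) (hC : Prop4LetterCPrAtRecord F N K k Ω U₀ 𝔥 levB C₂ c₄)
    (hnum : Prop4LetterNum b C₂ c₄ aC εC RV R') (haC : 0 < aC)
    -- (KL-H) the one-block kernel letter of `H₁(U₀)` of record, with plain and (3)/(3)-weighted fine-column sums
    {hk : Bond (F.P K).d (fun _ => (F.P K).sitesPerDir 0) → PBond (F.P K) k → ℝ} (hk0 : ∀ b' y, 0 ≤ hk b' y)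
    (hHk : ∀ (y : PBond (F.P K) k) (Z : Matrix (Fin N) (Fin N) ℂ) (b' : Bond (F.P K).d (fun _ => (F.P K).sitesPerDir 0)),
      ‖flat115 (H1prOfRecordAtBg F N K k Ω U₀ 𝔥 levB a hpos hQ
          ((NegSup.equiv (levWeight (F.L : ℝ) ((F.P K).eta k) levB 0) (Matrix (Fin N) (Fin N) ℂ)).symm (Pi.single y Z))) b'‖ ≤ hk b' y * ‖Z‖)
    {ΘH : ℝ} (hΘH : 0 ≤ ΘH) (hH1 : ∀ y, ∑ b', hk b' y ≤ ΘH) {ΘHw : ℝ} (hΘHw : 0 ≤ ΘHw)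
    (hHw : ∀ (bb : Bond (F.P K).d (fun _ => (F.P K).sitesPerDir 0)) (y : PBond (F.P K) k),
      ∑ b', levWeight (F.L : ℝ) ((F.P K).eta k) (bondLevLit F Ω k) 3 bb / levWeight (F.L : ℝ) ((F.P K).eta k) (bondLevLit F Ω k) 3 b' * hk b' y ≤ ΘHw)
    -- (KL-C) the one-bond coarse-column letter of `D C^{sl}` of record, and the window
    {gC : PBond (F.P K) k → Bond (F.P K).d (fun _ => (F.P K).sitesPerDir 0) → ℝ} (hgC0 : ∀ y bb, 0 ≤ gC y bb)
    (hCg : ∀ A : Space115Lit F N K k Ω U₀, ‖A‖ < εC + aC → ∀ (bb : Bond (F.P K).d (fun _ => (F.P K).sitesPerDir 0)) (X : Matrix (Fin N) (Fin N) ℂ)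
      (y : PBond (F.P K) k), ‖NegSup.equiv (levWeight (F.L : ℝ) ((F.P K).eta k) levB 0) (Matrix (Fin N) (Fin N) ℂ)
        (fderiv ℂ (CslprOfRecord F N K k Ω U₀ 𝔥 levB) A
          (single115 (lev₁ := pairLevLit F Ω k) (Dc := nabla115 ((F.P K).eta k) (unitsOfRecord F N U₀)) bb X)) y‖ ≤ gC y bb * ‖A‖ * ‖X‖)
    {G : ℝ} (hG0 : 0 ≤ G) (hG : ∀ bb, ∑ y, gC y bb ≤ G) (hq : (εC + aC) * ΘH * G ≤ 1 / 2)
    -- (KL-N) the one-block letter of `Δπ∘H₁(U₀)` of record, with (3)/(1)-weighted column sums and weighted row sums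
    {hk' : Bond (F.P K).d (fun _ => (F.P K).sitesPerDir 0) → PBond (F.P K) k → ℝ} (hk'0 : ∀ b' y, 0 ≤ hk' b' y)
    (hNk : ∀ (y : PBond (F.P K) k) (Z : Matrix (Fin N) (Fin N) ℂ) (b' : Bond (F.P K).d (fun _ => (F.P K).sitesPerDir 0)),
      ‖NegSup.equiv (levWeight (F.L : ℝ) ((F.P K).eta k) (bondLevLit F Ω k) 3) (Matrix (Fin N) (Fin N) ℂ)
        (Ncur (H1prOfRecordAtBg F N K k Ω U₀ 𝔥 levB a hpos hQ
          ((NegSup.equiv (levWeight (F.L : ℝ) ((F.P K).eta k) levB 0) (Matrix (Fin N) (Fin N) ℂ)).symm (Pi.single y Z)))) b'‖ ≤ hk' b' y * ‖Z‖)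
    {Θ' : ℝ} (hΘ'0 : 0 ≤ Θ')
    (hΘ' : ∀ (bb : Bond (F.P K).d (fun _ => (F.P K).sitesPerDir 0)) (y : PBond (F.P K) k),
      ∑ b', levWeight (F.L : ℝ) ((F.P K).eta k) (bondLevLit F Ω k) 3 bb / levWeight (F.L : ℝ) ((F.P K).eta k) (bondLevLit F Ω k) 1 b' * hk' b' y ≤ Θ')
    {N₁ : ℝ} (hN₁0 : 0 ≤ N₁)
    (hN₁ : ∀ b', ∑ y, levWeight (F.L : ℝ) ((F.P K).eta k) (bondLevLit F Ω k) 3 b' / levWeight (F.L : ℝ) ((F.P K).eta k) levB 0 y * hk' b' y ≤ N₁) :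
    Prop4LetterColumns (H1prOfRecordAtBg F N K k Ω U₀ 𝔥 levB a hpos hQ) (CslprOfRecord F N K k Ω U₀ 𝔥 levB) εC Ncur R'
      ((2 * (1 / (1 - 4 * b * C₂ * (εC + aC))) + 1) * ΘHw * G / aC)
      (2 * ΘHw * G * (1 / (1 - 4 * b * C₂ * (εC + aC))))
      (2 * Θ' * G * (1 / (1 - 4 * b * C₂ * (εC + aC)))) N₁ :=
  by
  unfold Prop4LetterHPrAtRecord at hH
  unfold Prop4LetterCPrAtRecord at hC
  exact prop4LetterColumns_of_kernelLetters hH hC hnum haC hk0 hHk hΘH hH1 hΘHw hHw hgC0 hCg hG0 hG hq Ncur hk'0 hNk hΘ'0 hΘ' hN₁0 hN₁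

/-- ★★ **(ℓd) AT THE RECORD FROM THE THREE PRIMITIVE KERNEL LETTERS** — def-Y's displayed `Prop4LetterColumnsPrAtRecord … 𝔥 … εC Gp R′ θ₃ θE θE′ N₁` ((86)–(89) for
`H := H1prOfRecordAtBg … 𝔥`, `C := CslprOfRecord … 𝔥`, `Δπ := DeltaPiCurOfRecord … Gp (QprimeOfRecord U₀)`; FRAMED twin) holds, with lit's closed `θ`'s, as soon as (ℓa-H), (ℓa-C), the numbers, and the kernel letters
(KL-H) (one-block letter `hk` of the record's `H₁(U₀)`: [B9] (3.126)∕(3.132)), (KL-C) (one-bond coarse-column letter `gC` of `D(CslprOfRecord … 𝔥)`: [B7] Prop. 5 (157)) with the window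
`(ε_C + a_C)Θ_HG ≤ ½`, and (KL-N) (one-block letter `hk′` of `Δπ∘H₁(U₀)`) are supplied — §1 at the record's slots.  The letters are DISPLAYED binders (inline, lit's shapes).
[cite: Balaban1985Variational, (86)–(89) p.291, (73) p.289, Prop. 4 (97)–(98) pp.292–293; Balaban1985BackgroundPropagators, (3.126) p.420, (3.132) p.422; Balaban1985Averaging, Proposition 5 (157) p.42] -/
theorem prop4LetterColumnsPrAtRecord_of_kernelLetters [DecidableEq (PBond (F.P K) k)] (𝔥 : FrameDatum (F.P K) N k U₀) (levB : PBond (F.P K) k → ℕ) (a : ℝ)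
    (hpos : ∀ x, x ≠ 0 → 0 < RCLike.re ⟪x, laplaceAOfRecord F N k U₀ (QprOfRecord F N k U₀ 𝔥) (QprimeOfRecord F N k U₀) a x⟫_ℂ)
    (hQ : Function.Surjective (QprOfRecord F N k U₀ 𝔥))
    (Gp : SiteL2K ℂ (F.P K).d (fun _ => (F.P K).sitesPerDir 0) (c0Rec F K k) (WRec N) →ₗ[ℂ]
      SiteL2K ℂ (F.P K).d (fun _ => (F.P K).sitesPerDir 0) (c0Rec F K k) (WRec N))
    {b C₂ c₄ aC εC RV R' : ℝ} (hH : Prop4LetterHPrAtRecord F N K k Ω U₀ 𝔥 levB a hpos hQ b) (hC : Prop4LetterCPrAtRecord F N K k Ω U₀ 𝔥 levB C₂ c₄)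
    (hnum : Prop4LetterNum b C₂ c₄ aC εC RV R') (haC : 0 < aC)
    -- (KL-H) the one-block kernel letter of `H₁(U₀)` of record, with plain and (3)/(3)-weighted fine-column sums
    {hk : Bond (F.P K).d (fun _ => (F.P K).sitesPerDir 0) → PBond (F.P K) k → ℝ} (hk0 : ∀ b' y, 0 ≤ hk b' y)
    (hHk : ∀ (y : PBond (F.P K) k) (Z : Matrix (Fin N) (Fin N) ℂ) (b' : Bond (F.P K).d (fun _ => (F.P K).sitesPerDir 0)),
      ‖flat115 (H1prOfRecordAtBg F N K k Ω U₀ 𝔥 levB a hpos hQ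
          ((NegSup.equiv (levWeight (F.L : ℝ) ((F.P K).eta k) levB 0) (Matrix (Fin N) (Fin N) ℂ)).symm (Pi.single y Z))) b'‖ ≤ hk b' y * ‖Z‖)
    {ΘH : ℝ} (hΘH : 0 ≤ ΘH) (hH1 : ∀ y, ∑ b', hk b' y ≤ ΘH) {ΘHw : ℝ} (hΘHw : 0 ≤ ΘHw)
    (hHw : ∀ (bb : Bond (F.P K).d (fun _ => (F.P K).sitesPerDir 0)) (y : PBond (F.P K) k),
      ∑ b', levWeight (F.L : ℝ) ((F.P K).eta k) (bondLevLit F Ω k) 3 bb / levWeight (F.L : ℝ) ((F.P K).eta k) (bondLevLit F Ω k) 3 b' * hk b' y ≤ ΘHw)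
    -- (KL-C) the one-bond coarse-column letter of `D C^{sl}` of record, and the window
    {gC : PBond (F.P K) k → Bond (F.P K).d (fun _ => (F.P K).sitesPerDir 0) → ℝ} (hgC0 : ∀ y bb, 0 ≤ gC y bb)
    (hCg : ∀ A : Space115Lit F N K k Ω U₀, ‖A‖ < εC + aC → ∀ (bb : Bond (F.P K).d (fun _ => (F.P K).sitesPerDir 0)) (X : Matrix (Fin N) (Fin N) ℂ)
      (y : PBond (F.P K) k), ‖NegSup.equiv (levWeight (F.L : ℝ) ((F.P K).eta k) levB 0) (Matrix (Fin N) (Fin N) ℂ)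
        (fderiv ℂ (CslprOfRecord F N K k Ω U₀ 𝔥 levB) A
          (single115 (lev₁ := pairLevLit F Ω k) (Dc := nabla115 ((F.P K).eta k) (unitsOfRecord F N U₀)) bb X)) y‖ ≤ gC y bb * ‖A‖ * ‖X‖)
    {G : ℝ} (hG0 : 0 ≤ G) (hG : ∀ bb, ∑ y, gC y bb ≤ G) (hq : (εC + aC) * ΘH * G ≤ 1 / 2)
    -- (KL-N) the one-block letter of `Δπ∘H₁(U₀)` of record, with (3)/(1)-weighted column sums and weighted row sums
    {hk' : Bond (F.P K).d (fun _ => (F.P K).sitesPerDir 0) → PBond (F.P K) k → ℝ} (hk'0 : ∀ b' y, 0 ≤ hk' b' y)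
    (hNk : ∀ (y : PBond (F.P K) k) (Z : Matrix (Fin N) (Fin N) ℂ) (b' : Bond (F.P K).d (fun _ => (F.P K).sitesPerDir 0)),
      ‖NegSup.equiv (levWeight (F.L : ℝ) ((F.P K).eta k) (bondLevLit F Ω k) 3) (Matrix (Fin N) (Fin N) ℂ)
        (DeltaPiCurOfRecord F N K k Ω U₀ Gp (QprimeOfRecord F N k U₀) (H1prOfRecordAtBg F N K k Ω U₀ 𝔥 levB a hpos hQ
          ((NegSup.equiv (levWeight (F.L : ℝ) ((F.P K).eta k) levB 0) (Matrix (Fin N) (Fin N) ℂ)).symm (Pi.single y Z)))) b'‖ ≤ hk' b' y * ‖Z‖)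
    {Θ' : ℝ} (hΘ'0 : 0 ≤ Θ')
    (hΘ' : ∀ (bb : Bond (F.P K).d (fun _ => (F.P K).sitesPerDir 0)) (y : PBond (F.P K) k),
      ∑ b', levWeight (F.L : ℝ) ((F.P K).eta k) (bondLevLit F Ω k) 3 bb / levWeight (F.L : ℝ) ((F.P K).eta k) (bondLevLit F Ω k) 1 b' * hk' b' y ≤ Θ')
    {N₁ : ℝ} (hN₁0 : 0 ≤ N₁)
    (hN₁ : ∀ b', ∑ y, levWeight (F.L : ℝ) ((F.P K).eta k) (bondLevLit F Ω k) 3 b' / levWeight (F.L : ℝ) ((F.P K).eta k) levB 0 y * hk' b' y ≤ N₁) :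
    Prop4LetterColumnsPrAtRecord F N K k Ω U₀ 𝔥 levB a hpos hQ εC Gp R'
      ((2 * (1 / (1 - 4 * b * C₂ * (εC + aC))) + 1) * ΘHw * G / aC)
      (2 * ΘHw * G * (1 / (1 - 4 * b * C₂ * (εC + aC))))
      (2 * Θ' * G * (1 / (1 - 4 * b * C₂ * (εC + aC)))) N₁ :=
  by
  unfold Prop4LetterColumnsPrAtRecord
  exact prop4LetterColumns_recordPr_of_kernelLetters F N K k Ω U₀ 𝔥 levB a (DeltaPiCurOfRecord F N K k Ω U₀ Gp (QprimeOfRecord F N k U₀)) hpos hQ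
    hH hC hnum haC hk0 hHk hΘH hH1 hΘHw hHw hgC0 hCg hG0 hG hq hk'0 hNk hΘ'0 hΘ' hN₁0 hN₁

/-! ## §2  Node-00 regime, framed: PROP. 4 AT THE RECORD from (ℓa-H)ᵖʳ + (KL-H)ᵖʳ + (KL-N)ᵖʳ + (KL-C)ᵖʳ + print's (14) (twin of ✓`prop4UniformAtRecord_node00_of_kernelLetters`) -/

/-- ★★★ **[B11] PROP. 4 (97)–(98) AT THE RECORD IN THE NODE-00 REGIME, REDUCED BY NAME TO (ℓa-H) + THE THREE PRIMITIVE KERNEL LETTERS + PRINT's (14).**  For `0 < k` and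
every site in `Ω_k`: GIVEN (ℓa-H) `Prop4LetterHAtRecord … b`, the one-block kernel letter (KL-H) of the record's `H₁(U₀)` (`hk`, fine-column sums `Θ_H`, (3)∕(3)-weighted `Θ_H^w`;
[B9] (3.126)∕(3.132)), the one-block letter (KL-N) of `Δπ∘H₁(U₀)` (`hk′`, (3)∕(1)-weighted columns `Θ′`, weighted rows `N₁`), the one-bond coarse-column letter (KL-C) of
`D(CslprOfRecord … 𝔥)` on `‖A‖ < 2r` (`gC`, `Σ_y gC ≤ G`; [B7] Prop. 5 (157)) with the window `2r·Θ_H·G ≤ ½`, print's (14) at all scales `j < k` (`hreg`) and `‖J‖ ≤ nJ` — THEN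
`Prop4UniformPrAtRecord … 𝔥 … r Gp C₄ R′` at the explicit k-free radii `r = min(c₄∕4, ½, (16(bC₂+1))⁻¹)`, `R′ = min(r, (1 − 8bC₂r)∕16)` (`C₂ = 3.2·10¹⁶LN`, `c₄ = (2·10¹¹LN)⁻¹`) with
`θ_E = 2Θ_H^wGℓ`, `θ₃ = (2ℓ + 1)Θ_H^wG∕r`, `θ_E′ = 2Θ′Gℓ`, `ℓ = (1 − 8bC₂r)⁻¹` inside F7's polynomial `C₄` — every constant a closed term in `L, N, b, α, Θ_H^w, Θ′, G, N₁, nJ`.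
F8ᵖʳ ✓`prop4UniformPrAtRecord_node00_of_HCol_pos` ∘ §1 with (ℓa-C)ᵖʳ := F6ᵖʳ ✓`prop4LetterCPrAtRecord_of_regular` (displayed `hc`∕(hdom)∕(hnear) threaded), numbers := ✓`prop4LetterNum_explicit` (`ε_C = a_C = r`, `R_V = 1∕16`).
HONEST: glue; (ℓa-H), (KL-H), (KL-N) are (R1)-class and (KL-C) is [B7]-Prop.-5-class — DISPLAYED, not proved; constants crude.
[cite: Balaban1985Variational, Prop. 4 (97)–(98) pp.292–293, (14) p.280, (44)–(46) p.285, (73) p.289, (86)–(89) p.291; Balaban1985BackgroundPropagators, (3.132) p.422; Balaban1985Averaging, Proposition 5 (157) p.42] -/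
theorem prop4UniformPrAtRecord_node00_of_kernelLetters [DecidableEq (PBond (F.P K) k)] (𝔥 : FrameDatum (F.P K) N k U₀) (levB : PBond (F.P K) k → ℕ) (a : ℝ)
    (hpos : ∀ x, x ≠ 0 → 0 < RCLike.re ⟪x, laplaceAOfRecord F N k U₀ (QprOfRecord F N k U₀ 𝔥) (QprimeOfRecord F N k U₀) a x⟫_ℂ)
    (hQ : Function.Surjective (QprOfRecord F N k U₀ 𝔥))
    (Gp : SiteL2K ℂ (F.P K).d (fun _ => (F.P K).sitesPerDir 0) (c0Rec F K k) (WRec N) →ₗ[ℂ]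
      SiteL2K ℂ (F.P K).d (fun _ => (F.P K).sitesPerDir 0) (c0Rec F K k) (WRec N))
    {b α nJ : ℝ} (hkpos : 0 < k) (hb : 0 ≤ b) (hΩ : ∀ x, x ∈ Ω k) (hα0 : 0 ≤ α) (hα : α * (11000000 * N) ≤ 1)
    (hreg : ∀ j, j < k → PlaqSmall (α * ((F.L : ℝ) ^ j * (F.P K).eta k) ^ 2) (Averaging.iter (avOfRecord F N K) j U₀))
    {c𝔥 : ℝ} (hc : c𝔥 ≤ 1000)
    (hdom : ∀ Y : PBond (F.P K) 0 → Matrix (Fin N) (Fin N) ℂ, (∀ b, (Y b).trace = 0) → (F.L : ℝ) ^ k * ‖Y‖ < 1 / (25000000000 * (F.L : ℝ) * N) →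
      expOver U₀ Y ∈ 𝔥.dom)
    (hnear : ∀ Y : PBond (F.P K) 0 → Matrix (Fin N) (Fin N) ℂ, (∀ b, (Y b).trace = 0) → (F.L : ℝ) ^ k * ‖Y‖ < 1 / (25000000000 * (F.L : ℝ) * N) →
      ∀ y : Site (F.P K) k, ‖𝔥.map (expOver U₀ Y) y - 1‖ ≤ c𝔥 * ((F.L : ℝ) ^ k * ‖Y‖) ∧ ‖𝔥.inv (expOver U₀ Y) y - 1‖ ≤ c𝔥 * ((F.L : ℝ) ^ k * ‖Y‖))
    (hH : Prop4LetterHPrAtRecord F N K k Ω U₀ 𝔥 levB a hpos hQ b)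
    -- (KL-H)
    {hk : Bond (F.P K).d (fun _ => (F.P K).sitesPerDir 0) → PBond (F.P K) k → ℝ} (hk0 : ∀ b' y, 0 ≤ hk b' y)
    (hHk : ∀ (y : PBond (F.P K) k) (Z : Matrix (Fin N) (Fin N) ℂ) (b' : Bond (F.P K).d (fun _ => (F.P K).sitesPerDir 0)),
      ‖flat115 (H1prOfRecordAtBg F N K k Ω U₀ 𝔥 levB a hpos hQ
          ((NegSup.equiv (levWeight (F.L : ℝ) ((F.P K).eta k) levB 0) (Matrix (Fin N) (Fin N) ℂ)).symm (Pi.single y Z))) b'‖ ≤ hk b' y * ‖Z‖)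
    {ΘH : ℝ} (hΘH : 0 ≤ ΘH) (hH1 : ∀ y, ∑ b', hk b' y ≤ ΘH) {ΘHw : ℝ} (hΘHw : 0 ≤ ΘHw)
    (hHw : ∀ (bb : Bond (F.P K).d (fun _ => (F.P K).sitesPerDir 0)) (y : PBond (F.P K) k),
      ∑ b', levWeight (F.L : ℝ) ((F.P K).eta k) (bondLevLit F Ω k) 3 bb / levWeight (F.L : ℝ) ((F.P K).eta k) (bondLevLit F Ω k) 3 b' * hk b' y ≤ ΘHw)
    -- (KL-C) on `‖A‖ < 2r` and the window `2r·Θ_H·G ≤ ½`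
    {gC : PBond (F.P K) k → Bond (F.P K).d (fun _ => (F.P K).sitesPerDir 0) → ℝ} (hgC0 : ∀ y bb, 0 ≤ gC y bb)
    (hCg : letI C₂ : ℝ := 32000000000000000 * (F.L : ℝ) * N
      letI c₄ : ℝ := 1 / (200000000000 * (F.L : ℝ) * N)
      letI r : ℝ := min (c₄ / 4) (min (1 / 2) (1 / (16 * (b * C₂ + 1))))
      ∀ A : Space115Lit F N K k Ω U₀, ‖A‖ < r + r → ∀ (bb : Bond (F.P K).d (fun _ => (F.P K).sitesPerDir 0)) (X : Matrix (Fin N) (Fin N) ℂ)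
      (y : PBond (F.P K) k), ‖NegSup.equiv (levWeight (F.L : ℝ) ((F.P K).eta k) levB 0) (Matrix (Fin N) (Fin N) ℂ)
        (fderiv ℂ (CslprOfRecord F N K k Ω U₀ 𝔥 levB) A
          (single115 (lev₁ := pairLevLit F Ω k) (Dc := nabla115 ((F.P K).eta k) (unitsOfRecord F N U₀)) bb X)) y‖ ≤ gC y bb * ‖A‖ * ‖X‖)
    {G : ℝ} (hG0 : 0 ≤ G) (hG : ∀ bb, ∑ y, gC y bb ≤ G)
    (hq : letI C₂ : ℝ := 32000000000000000 * (F.L : ℝ) * N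
      letI c₄ : ℝ := 1 / (200000000000 * (F.L : ℝ) * N)
      letI r : ℝ := min (c₄ / 4) (min (1 / 2) (1 / (16 * (b * C₂ + 1))))
      (r + r) * ΘH * G ≤ 1 / 2)
    -- (KL-N)
    {hk' : Bond (F.P K).d (fun _ => (F.P K).sitesPerDir 0) → PBond (F.P K) k → ℝ} (hk'0 : ∀ b' y, 0 ≤ hk' b' y)
    (hNk : ∀ (y : PBond (F.P K) k) (Z : Matrix (Fin N) (Fin N) ℂ) (b' : Bond (F.P K).d (fun _ => (F.P K).sitesPerDir 0)),
      ‖NegSup.equiv (levWeight (F.L : ℝ) ((F.P K).eta k) (bondLevLit F Ω k) 3) (Matrix (Fin N) (Fin N) ℂ)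
        (DeltaPiCurOfRecord F N K k Ω U₀ Gp (QprimeOfRecord F N k U₀) (H1prOfRecordAtBg F N K k Ω U₀ 𝔥 levB a hpos hQ
          ((NegSup.equiv (levWeight (F.L : ℝ) ((F.P K).eta k) levB 0) (Matrix (Fin N) (Fin N) ℂ)).symm (Pi.single y Z)))) b'‖ ≤ hk' b' y * ‖Z‖)
    {Θ' : ℝ} (hΘ'0 : 0 ≤ Θ')
    (hΘ' : ∀ (bb : Bond (F.P K).d (fun _ => (F.P K).sitesPerDir 0)) (y : PBond (F.P K) k),
      ∑ b', levWeight (F.L : ℝ) ((F.P K).eta k) (bondLevLit F Ω k) 3 bb / levWeight (F.L : ℝ) ((F.P K).eta k) (bondLevLit F Ω k) 1 b' * hk' b' y ≤ Θ')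
    {N₁ : ℝ} (hN₁0 : 0 ≤ N₁)
    (hN₁ : ∀ b', ∑ y, levWeight (F.L : ℝ) ((F.P K).eta k) (bondLevLit F Ω k) 3 b' / levWeight (F.L : ℝ) ((F.P K).eta k) levB 0 y * hk' b' y ≤ N₁)
    (hJ : ‖JOfRecordAtBg F N K k Ω U₀‖ ≤ nJ) :
    letI C₂ : ℝ := 32000000000000000 * (F.L : ℝ) * N
    letI c₄ : ℝ := 1 / (200000000000 * (F.L : ℝ) * N)
    letI r : ℝ := min (c₄ / 4) (min (1 / 2) (1 / (16 * (b * C₂ + 1))))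
    letI R' : ℝ := min r ((1 - 4 * b * C₂ * (r + r)) * (1 / 16))
    letI CV : ℝ := 1024 * (((F.P K).d - 1 : ℕ) : ℝ) * ((1 : ℝ) * 1) ^ 3 * N * (α * (1 : ℝ) ^ 2 + 1 / 16)
        + (((F.P K).d - 1 : ℕ) : ℝ) * ((1 : ℝ) * 1) ^ 3 * (136 + 2 * ((1 : ℝ) * 1)) * N
    letI θ₃ : ℝ := (2 * (1 / (1 - 4 * b * C₂ * (r + r))) + 1) * ΘHw * G / r
    letI θE : ℝ := 2 * ΘHw * G * (1 / (1 - 4 * b * C₂ * (r + r)))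
    letI θE' : ℝ := 2 * Θ' * G * (1 / (1 - 4 * b * C₂ * (r + r)))
    Prop4UniformPrAtRecord F N K k Ω U₀ 𝔥 levB a hpos hQ r Gp
      ((N * θ₃ * nJ + (N₁ * C₂ * (1 / (1 - 4 * b * C₂ * (r + r))) ^ 2 + N * θE')
        + N * θE * (N₁ * C₂ * (1 / (1 - 4 * b * C₂ * (r + r))) ^ 2) * R'
        + N * (1 + θE * R') * CV * (1 / (1 - 4 * b * C₂ * (r + r))) ^ 2)) R' := by
  have hLN : (0 : ℝ) < (F.L : ℝ) * N := mul_pos Fact.out (by exact_mod_cast Nat.pos_of_ne_zero (NeZero.ne N))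
  have hC₂ : (0 : ℝ) ≤ 32000000000000000 * (F.L : ℝ) * N := by rw [mul_assoc]; positivity
  have hc₄ : (0 : ℝ) < 1 / (200000000000 * (F.L : ℝ) * N) := by rw [mul_assoc]; positivity
  have hr0 := radius_pos hb hC₂ hc₄ one_pos
  exact prop4UniformPrAtRecord_node00_of_HCol_pos F N K k Ω U₀ 𝔥 levB a hpos hQ Gp hkpos hb hΩ hα0 hα hreg hc hdom hnear hH
    (prop4LetterColumnsPrAtRecord_of_kernelLetters F N K k Ω U₀ 𝔥 levB a hpos hQ Gp hH (prop4LetterCPrAtRecord_of_regular F N k Ω U₀ 𝔥 levB hΩ hα0 hα hreg hc hdom hnear)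
      (prop4LetterNum_explicit (RV := 1 / 16) hb hC₂ hc₄ (by norm_num)) hr0 hk0 hHk hΘH hH1 hΘHw hHw hgC0 hCg hG0 hG hq hk'0 hNk hΘ'0 hΘ' hN₁0 hN₁) hJ

end Record

end Summit.QuantumFields.YangMills.Theorems.Prop4UniformAtRecord

end
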